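import Summits.BirchSwinnertonDyer.BirchSwinnertonDyer.Theorems.ByReductionTypeAtTwoSupersingularFlatBlindCardHondaPT
import Summits.BirchSwinnertonDyer.BirchSwinnertonDyer.Theorems.SchneiderFreeAdditiveX3PoitouTateReciprocitySumHolds
import HarnessLib

/-!
# Route `ByReductionTypeAtTwo` (rung K4), crux `SupersingularRankZeroAtTwo` (item stmt-BirchSwinnertonDyer-19097), line
# `odd_blind_package` (registry v2.11), slot 5 CDC_H `OddBlindPackage.FlatBlindControlCardHondaAtTwo`:
# **CDC_H UNCONDITIONALLY — the print binder hPT IS A TREE THEOREM** (cell `bsd-2adic`, LEAD ss-1 GEN 23)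

HONEST FRAMING: THEOREMS ONLY (no definition, no named fact, no `sorry`, no instance); a helper
(`--supports stmt-BirchSwinnertonDyer-19097`).

The registry v2.11 of the line feeds slot 5 by `OddBlindLocal.flatBlindControlCardHondaAtTwo_of_PT hPub.2.2.2` (★★★ p820366), where
`hPT = Literature.NumberTheory.GaloisCohomology.poitouTate_selmerStructure_duality_real ℚ` (Poitou–Tate duality for finite Selmer
structures over `ℚ`, five-conjunct form `IsPerfect ∧ SumLocalTermEqZero ∧ UnramifiedOrthogonal ∧ SelmerComplement ∧ InjectiveAtRealPlaces`;
Milne *ADT* I Ex. 1.6 (c), Cor. 2.3, Thm. 2.6, Thm. 4.10 (b); Howard 2004 Thm. 2.1.11) was carried as the last conjunct of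
`PublishedInputsAtTwo` and described as «a cited Literature `Prop`, NOT proved in the tree».  THAT DESCRIPTION IS OUT OF DATE: since
2026-08-28 the fact is a THEOREM OF THE TREE for every number field —
`SchneiderFreeAdditiveX3.PoitouTateReduction.poitouTate_selmerStructure_duality_real_holds (K)` (cell `bsd-schneider`, door-c4 g18,
p626891, module `Theorems.SchneiderFreeAdditiveX3PoitouTateReciprocitySumHolds`; also recorded for `K = ℚ` as item 19417
`InputsPoitouTateSelmer.inertBadSignedBranches_poitouTateRealRat_proof`).  Feeding it BY NAME:

* `poitouTateReal_rat` — `poitouTate_selmerStructure_duality_real ℚ`, the `K = ℚ` instance (the exact type of the binder `hPT`);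
* `HTC7globPT_natCard_kummerRelaxed_eq_holds` — (P1) ★★ p819324 (t42 GEN 42) WITHOUT its binder `hPT`;
* `hglob_holds` — the position-count binder `hglob` of ★★ p816472 WITHOUT `hPT` (= `hglob_of_PT poitouTateReal_rat`);
* ★★★ `flatBlindControlCardHondaAtTwo_holds : ‹body of OddBlindPackage.FlatBlindControlCardHondaAtTwo, VERBATIM›` — **slot 5 CDC_H of
  the line is an UNCONDITIONAL theorem of the tree** (= `flatBlindControlCardHondaAtTwo_of_PT poitouTateReal_rat`).

Consequences for the line (bookkeeping for the successor registry, NOT done here): the conjunct hPT of `PublishedInputsAtTwo` is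
dischargeable (`PublishedInputsAtTwo` can shrink back to its v2.10.1 body), and the algebraic blind law K67-A
(`flatBlindRegulatorCharacteristicHondaAtTwo_of hEC hNF hCD`) now holds modulo NF♭ (slot 4) ALONE (EC ★ p797558, CD this file).
Nothing is booked; 19097 stays OPEN on its research stubs; BSD is proved for no curve by any of this.  bears_on: K4 (19097).

References: [MilneADT2006] I Ex. 1.6 (c), Thm. 2.8, Thm. 4.10; [Howard2004HeegnerKolyvagin] Thm. 2.1.11; [GreenbergLNM1716] §3–§4;
[Sprung2012] Def. 7.9/7.11, Thm. 2.2.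
-/

set_option autoImplicit false
set_option linter.dupNamespace false

noncomputable section

open scoped Classical NumberField AddSubgroup ContRepresentation

namespace Summit.BirchSwinnertonDyer.BirchSwinnertonDyer.Theorems

namespace OddBlindLocal

open NumberField IsDedekindDomain Field WeierstrassCurve Literature.NumberTheory.EllipticCurves
  Literature.NumberTheory.EllipticCurves.IwasawaDual Literature.NumberTheory.GaloisRepresentations
  Literature.NumberTheory.GaloisCohomology ZpExtension Literature.NumberTheory.EllipticCurves.Kobayashi2003
  Literature.NumberTheory.EllipticCurves.Sprung2017 Literature.NumberTheory.EllipticCurves.Sprung2012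
  Literature.NumberTheory.EllipticCurves.Rank1Residual Summit.BirchSwinnertonDyer.Rank1Residual.Additive
open Literature.NumberTheory.GaloisRepresentations.DiscreteGaloisModule (SelmerStructure)
open Summit.BirchSwinnertonDyer.Rank1Residual.X11b Summit.BirchSwinnertonDyer.Rank1Residual.X11b.KummerPT

/-- **hPT over `ℚ` IS A THEOREM**: Poitou–Tate duality for finite Selmer structures over `ℚ` with the real-place clause
(`poitouTate_selmerStructure_duality_real ℚ`, the exact type of the line's binder `hPT`), the `K = ℚ` instance of the tree theorem
`SchneiderFreeAdditiveX3.PoitouTateReduction.poitouTate_selmerStructure_duality_real_holds` (p626891).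
[cite: MilneADT2006, Ch. I, Example 1.6 (c) (p. 19) and Thm. 4.10 (b) (p. 57)] [cite: Howard2004HeegnerKolyvagin, Thm. 2.1.11 (arXiv:1202.6340 p. 6)] -/
theorem poitouTateReal_rat : Literature.NumberTheory.GaloisCohomology.poitouTate_selmerStructure_duality_real ℚ :=
  SchneiderFreeAdditiveX3.PoitouTateReduction.poitouTate_selmerStructure_duality_real_holds ℚ

/-- **(P1) UNCONDITIONALLY** — the Poitou–Tate count «relaxed-vs-strict at `v ∣ p`» of ★★ p819324
(`HTC7globPT_natCard_kummerRelaxed_eq`, t42 GEN 42), its print binder `hPT` discharged by `poitouTateReal_rat`: for `E/ℚ`, a prime `p`,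
the place `v ∣ p` with `E(ℚ_v)[p] = 0` (and the unused global binder `E(ℚ)[p] = 0` kept verbatim) and every `J ≥ 1`,
`#H¹_{𝓚^{v}}(ℚ, E[p^J]) = p^J · #H¹_{𝓚_{v}}(ℚ, E[p^J])`.
[cite: MilneADT2006, I Thm. 2.8, Thm. 4.10] [cite: GreenbergLNM1716, §4 pp. 122–124] -/
theorem HTC7globPT_natCard_kummerRelaxed_eq_holds :
    ∀ (E : WeierstrassCurve ℚ) [E.IsElliptic] (p : ℕ) [Fact p.Prime]
      (v : HeightOneSpectrum (𝓞 ℚ)), ((p : ℕ) : 𝓞 ℚ) ∈ v.asIdeal →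
      (∀ P : (E.baseChange (v.adicCompletion ℚ)).toAffine.Point, p • P = 0 → P = 0) →
      (∀ P : E.toAffine.Point, p • P = 0 → P = 0) →
      ∀ J : ℕ, 1 ≤ J →
        Nat.card (SelmerStructure.selmerGroup (ρ := E.torsionGaloisModule ((p ^ J : ℕ) : ℤ))
            (KummerPT.kummerRelaxed E (p ^ J) {(Sum.inr v : Place ℚ)})) =
          p ^ J * Nat.card (SelmerStructure.selmerGroup (ρ := E.torsionGaloisModule ((p ^ J : ℕ) : ℤ))
            (KummerPT.kummerStrict E (p ^ J) {(Sum.inr v : Place ℚ)})) :=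
  HTC7globPT_natCard_kummerRelaxed_eq poitouTateReal_rat

/-- **(hglob) UNCONDITIONALLY**: the generic «position count for a complementary line» (binder `hglob` of ★★ p816472
`position_of_complement_of_lineCount`, VERBATIM), its print binder discharged: `hglob_of_PT poitouTateReal_rat`.
[cite: GreenbergLNM1716, §4 pp. 122–124] [cite: MilneADT2006, I Thm. 4.10] -/
theorem hglob_holds :
    ∀ (E : WeierstrassCurve ℚ) [E.IsElliptic] (p : ℕ) [Fact p.Prime]
      (v : HeightOneSpectrum (𝓞 ℚ)), ((p : ℕ) : 𝓞 ℚ) ∈ v.asIdeal →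
      (∀ P : (E.baseChange (v.adicCompletion ℚ)).toAffine.Point, p • P = 0 → P = 0) →
      (∀ P : (E.baseChange ℚ_[p]).toAffine.Point, p • P = 0 → P = 0) →
      (∀ P : E.toAffine.Point, p • P = 0 → P = 0) →
      E.mordellWeilRank = 1 → Finite (AddCommGroup.primaryComponent E.sha p) →
      ∃ J₂ : ℕ, ∀ J : ℕ, J₂ ≤ J →
      ∀ (L : AddSubgroup (galoisCohomology ((E.torsionGaloisModule ((p ^ J : ℕ) : ℤ)).restrictField (v.adicCompletion ℚ)) 1)),
        L ⊓ E.kummerLocalConditionAt ((p ^ J : ℕ) : ℤ) (v.adicCompletion ℚ) = ⊥ →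
        L ⊔ E.kummerLocalConditionAt ((p ^ J : ℕ) : ℤ) (v.adicCompletion ℚ) = ⊤ →
      ∀ (𝓛 : SelmerStructure (E.torsionGaloisModule ((p ^ J : ℕ) : ℤ))),
        (∀ w : InfinitePlace ℚ, 𝓛 (Sum.inl w) = E.kummerLocalConditionAt ((p ^ J : ℕ) : ℤ) w.Completion) →
        𝓛 (Sum.inr v) = L →
        (∀ v' : HeightOneSpectrum (𝓞 ℚ), v' ≠ v → 𝓛 (Sum.inr v') = E.kummerLocalConditionAt ((p ^ J : ℕ) : ℤ) (v'.adicCompletion ℚ)) →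
      ∀ (lam : (E.baseChange ℚ_[p]).toAffine.Point →+ ℤ_[p]), (∀ X, lam X = 0 ↔ IsOfFinAddOrder X) → Function.Surjective lam →
      ∀ (P₁ : E.toAffine.Point), (∀ P : E.toAffine.Point, ∃ (a : ℤ) (t : E.toAffine.Point), IsOfFinAddOrder t ∧ P = a • P₁ + t) →
        Nat.card 𝓛.selmerGroup =
          Nat.card ↥(E.selmerGroupPInfty p ⊓ selmerLocalKerPrimaryTorsion E ℚ_[p] p) *
            p ^ (lam (Affine.Point.baseChange (W' := E) ℚ ℚ_[p] P₁)).valuation :=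
  hglob_of_PT poitouTateReal_rat

/-- ★★★ **CDC_H UNCONDITIONALLY.** The registry statement `OddBlindPackage.FlatBlindControlCardHondaAtTwo` (slot 5 of line
`odd_blind_package`; body VERBATIM as the conclusion) is a THEOREM OF THE TREE: `flatBlindControlCardHondaAtTwo_of_PT poitouTateReal_rat`
(★★★ p820366 with its only displayed hypothesis, the print binder hPT, discharged by the tree theorem p626891).  On the odd-twist half
`w·χ₈(N) = −1`, for the cyclotomic data, Honda–Sprung local data at the place over `2` admitting a legal Honda system, every globally minimal
model `W₂` of `E^{(2)}` of rank `1` with finite `Ш[2^∞]` and every non-torsion `P`: IF the `ψ₂`-anti-invariants `Sel♭(E/ℚ_∞)[γ+1]` are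
finite THEN `v₂ #Sel♭(E/ℚ_∞)[γ+1] = v₂ #Ш(W₂)[2^∞] + v₂ Tam(W₂) + 2·(ord₂ log_{Ŵ₂} P − v₂ [W₂(ℚ) : ℤP])`.  A helper toward 19097 (slot 5
closed in the kernel; the crux stays OPEN on its research stubs); BSD is proved for no curve.
[cite: MilneADT2006, I Thm. 4.10] [cite: GreenbergLNM1716, §3 Lemma 3.3 and §4 pp. 122–124] [cite: Sprung2012, Def. 7.9, Def. 7.11, Thm. 2.2] -/
theorem flatBlindControlCardHondaAtTwo_holds :
    ∀ (W : WeierstrassCurve ℚ) [W.IsElliptic] [W.IsGloballyMinimal],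
    ¬ W.HasCM → GoodSS W 2 → W.rootNumber * ZMod.χ₈ (W.conductorNorm ℤ : ZMod 8) = -1 →
    ∀ (κ : ZpExtension ℚ 2) (γ : Field.absoluteGaloisGroup ℚ),
      κ.IsCyclotomic → κ.IsTopGenerator γ → IsCyclotomicVariable 2 γ →
    ∀ (v : HeightOneSpectrum (𝓞 ℚ)), (2 : 𝓞 ℚ) ∈ v.asIdeal →
    ∀ (g : Field.absoluteGaloisGroup (v.adicCompletion ℚ)) (c : ℕ → localPoints W (v.adicCompletion ℚ)),
      κ.IsTopGenerator (resGalOfEmb (closureEmb (K := ℚ) (v.adicCompletion ℚ)) g) →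
      (∀ n, c n ∈ localLayerPointsOfEmb κ (closureEmb (K := ℚ) (v.adicCompletion ℚ)) W n) →
      (∀ n, 1 ≤ n → localTraceOfEmb κ (closureEmb (K := ℚ) (v.adicCompletion ℚ)) W n (n + 1)
        (c (n + 1)) = W.frobeniusTrace 2 • c n - c (n - 1)) →
      (∀ z₀ : localLayerPointsOfEmb κ (closureEmb (K := ℚ) (v.adicCompletion ℚ)) W 0 →+ ℤ_[2],
        evalOn W (localLayerPointsOfEmb κ (closureEmb (K := ℚ) (v.adicCompletion ℚ)) W 0) z₀ (c 0) = 0 →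
          z₀ = 0) →
      (∀ a : ℤ_[2],
        (∃ z₀ : localLayerPointsOfEmb κ (closureEmb (K := ℚ) (v.adicCompletion ℚ)) W 0 →+ ℤ_[2],
          evalOn W (localLayerPointsOfEmb κ (closureEmb (K := ℚ) (v.adicCompletion ℚ)) W 0) z₀ (c 0) = 2 * a) →
        ∃ y : localLayerPointsOfEmb κ (closureEmb (K := ℚ) (v.adicCompletion ℚ)) W 0 →+ ℤ_[2],
          evalOn W (localLayerPointsOfEmb κ (closureEmb (K := ℚ) (v.adicCompletion ℚ)) W 0) y (c 0) = a) →
      (∃ cneg : localPoints W (v.adicCompletion ℚ),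
        Summit.BirchSwinnertonDyer.Rank1Residual.F1Sign2.IsHondaSystemAtTwo κ (closureEmb (K := ℚ) (v.adicCompletion ℚ)) W
          (W.frobeniusTrace 2) g cneg c) →
    ∀ (W₂ : WeierstrassCurve ℚ) [W₂.IsElliptic] [W₂.IsGloballyMinimal],
      (∃ C : WeierstrassCurve.VariableChange ℚ, C • W.quadraticTwist 2 = W₂) →
      W₂.mordellWeilRank = 1 → Finite (AddCommGroup.primaryComponent W₂.sha 2) →
    ∀ (ι : ℚ →+* ℚ_[2]) (P : (W₂.baseChange ℚ).toAffine.Point), ¬ IsOfFinAddOrder P →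
      Finite (endInvariants (conjSharpFlatSelmerInfty W κ (closureEmb (K := ℚ) (v.adicCompletion ℚ))
        (W.frobeniusTrace 2) g c .flat γ + 1)) →
      (padicValNat 2 (Nat.card (endInvariants (conjSharpFlatSelmerInfty W κ
          (closureEmb (K := ℚ) (v.adicCompletion ℚ)) (W.frobeniusTrace 2) g c .flat γ + 1))) : ℤ) =
        (padicValNat 2 (Nat.card (AddCommGroup.primaryComponent W₂.sha 2)) : ℤ) +
          (padicValNat 2 W₂.tamagawaProduct : ℤ) +
          2 * (Literature.NumberTheory.EllipticCurves.padicLogOrd W₂ 2 ι P -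
            (padicValNat 2 (AddSubgroup.zmultiples P).index : ℤ)) :=
  flatBlindControlCardHondaAtTwo_of_PT poitouTateReal_rat

end OddBlindLocal

end Summit.BirchSwinnertonDyer.BirchSwinnertonDyer.Theorems

end
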